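import Mathlib
import Literature.Geometry.Symplectic.JHolomorphicSheetDichotomy
import Literature.Topology.PlaneTopology.ZerosPersist
import HarnessLib

/-!
# Persistence of an isolated intersection of two `J`-holomorphic sheets (flat form)

The flat (single chart, `dim F = 4`) form of the persistence half of POSITIVITY OF
INTERSECTIONS of `J`-holomorphic curves in dimension four (D. McDuff (1991), Thm 1.1 and §5
(5.1) cases (i)–(ii): an isolated intersection point `x` of two `J`-curves `C`, `C'` with `C'`
non-singular at `x` contributes `k_x ≥ 1` to `C · C'`; Lemma 4.2(ii) / Lemma 4.3: intersection
numbers of pairs of discs whose boundaries avoid the other disc are unchanged under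
(`C¹`-small) deformation, so a non-zero local index forces the perturbed discs to meet).

* `isolatedIntersection_persists_flat` — let `b, v : ℂ → F` be smooth, `J`-holomorphic near `0`
  for a smooth operator field `J` with `J² = -1` along `b`, `b` immersed at `0`, `v 0 = b 0`, and
  suppose the intersection is isolated: `v s = b t` with `s, t` small forces `s = t = 0`. If
  `u n → v` locally uniformly and `w n → b` locally uniformly TOGETHER WITH FIRST DERIVATIVES on
  a neighbourhood of `0` (`u n` continuous, `w n` smooth there), then for every `ρ > 0`,
  eventually `u n s = w n t` for some `s, t ∈ B(0, ρ)`.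

Proof (the tree's route to McDuff's statement, avoiding four-dimensional intersection numbers;
McDuff–Salamon (2012), §2.6 and App. E): read everything in the sheet chart `e` of `b`
(`Literature.Geometry.Symplectic.sheet_dichotomy`): the first sheet is the axis
`e.symm (b ζ) = (ζ, 0)`, the second is `e.symm (v ζ) = (a ζ, c ζ)`, and since the intersection
is isolated the normal coordinate `c` is not identically zero near `0`, so `0` is an isolated
zero of `c` of POSITIVE winding number (similarity principle). The approximants `w n` of the first
sheet are `C¹`-close to `b` on a closed disc `K₁`, so `P_n := (e.symm ∘ w n).1` is a `C¹`-small
perturbation of the identity and has a continuous right inverse `g_n` on the quarter disc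
(`perturbedIdentityInverse`: the sheet of `w n` is a graph over the axis); on
`K₂ := closedBall 0 ε` the continuous functions `d_n ζ := Q^u_n ζ - Q^w_n (g_n (P^u_n ζ))`
(`(P^u_n, Q^u_n) := e.symm ∘ u n`, `Q^w_n := (e.symm ∘ w n).2`) converge to `c` uniformly on
the circle `‖ζ‖ = ε`, hence
(`Literature.Topology.PlaneTopology.eventually_exists_zero_of_tendstoUniformlyOn`) eventually
vanish somewhere in `K₂`; a zero `z` gives `e.symm (u n z) = e.symm (w n t)` with
`t := g_n (P^u_n z) ∈ K₁`, i.e. `u n z = w n t`.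

Also in this file (namespace `IntersectionPersist`, ported from the crux `TameOrBrodyR4` of
summit `SmoothPoincare4`, `Theorems/SullivanDualTameOrBrodyR4Helper{PerturbedIdentityInverse,
ComposeC1Convergence,PairCoincide}.lean`, where the same device proves that sheets of a
`C¹_loc`-limit of injective curves coincide): the quantitative inverse function theorem for a
`C¹`-small perturbation of the identity of a closed ball in a real Banach space, and
"`C¹`-convergence survives a smooth change of coordinates" with local hypotheses.

## References

* D. McDuff, *The local behaviour of holomorphic curves in almost complex 4-manifolds*,
  J. Differential Geom. 34 (1991) 143–164, Thm 1.1, Lemma 4.2, Lemma 4.3, §5 (5.1).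
  [McDuff1991LocalBehaviour]
* D. McDuff, D. Salamon, *J-holomorphic curves and symplectic topology*, 2nd ed. (2012), §2.6,
  App. E. [McDuffSalamon2012]
-/

noncomputable section

open scoped ContDiff Topology NNReal
open Set Function Metric Filter
open Literature.Topology.PlaneTopology Literature.Analysis.Complex

namespace Literature.Geometry.Symplectic

variable {F : Type*} [NormedAddCommGroup F] [NormedSpace ℝ F]

namespace IntersectionPersist

/-! ### Quantitative inverse function theorem for a `C¹`-small perturbation of the identity -/

section PerturbedIdentity

variable {E : Type*} [NormedAddCommGroup E] [NormedSpace ℝ E]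

/-- Key estimate: if `‖p' - id‖ ≤ 1/2` on the closed ball then `p - id` is `1/2`-Lipschitz
there (mean value inequality on the convex set `closedBall z₀ r`). [folklore] -/
theorem norm_sub_sub_le (p : E → E) (p' : E → (E →L[ℝ] E)) (z₀ : E) (r : ℝ)
    (hp : ∀ z ∈ closedBall z₀ r, HasFDerivAt p (p' z) z)
    (hd : ∀ z ∈ closedBall z₀ r, ‖p' z - ContinuousLinearMap.id ℝ E‖ ≤ 1 / 2)
    {x y : E} (hx : x ∈ closedBall z₀ r) (hy : y ∈ closedBall z₀ r) :
    ‖p y - p x - (y - x)‖ ≤ 1 / 2 * ‖y - x‖ := by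
  have h := (convex_closedBall z₀ r).norm_image_sub_le_of_norm_hasFDerivWithin_le'
    (f := p) (f' := p') (φ := ContinuousLinearMap.id ℝ E) (C := 1 / 2)
    (fun z hz => (hp z hz).hasFDerivWithinAt) hd hx hy
  simpa using h

/-- `‖y - x‖ ≤ 2 ‖p y - p x‖` on the closed ball when `‖p' - id‖ ≤ 1/2` there; in particular
`p` is injective on the ball. [folklore] -/
theorem norm_sub_le_two_mul (p : E → E) (p' : E → (E →L[ℝ] E)) (z₀ : E) (r : ℝ)
    (hp : ∀ z ∈ closedBall z₀ r, HasFDerivAt p (p' z) z)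
    (hd : ∀ z ∈ closedBall z₀ r, ‖p' z - ContinuousLinearMap.id ℝ E‖ ≤ 1 / 2)
    {x y : E} (hx : x ∈ closedBall z₀ r) (hy : y ∈ closedBall z₀ r) :
    ‖y - x‖ ≤ 2 * ‖p y - p x‖ := by
  have h1 := norm_sub_sub_le p p' z₀ r hp hd hx hy
  have h2 : ‖y - x‖ ≤ ‖p y - p x‖ + ‖p y - p x - (y - x)‖ := by
    calc ‖y - x‖ = ‖(p y - p x) - (p y - p x - (y - x))‖ := by congr 1; abel
      _ ≤ ‖p y - p x‖ + ‖p y - p x - (y - x)‖ := norm_sub_le _ _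
  linarith

/-- Surjectivity onto the quarter ball in a Banach space: Banach's fixed point theorem for
`T x = x - (p x - y)` on the complete set `closedBall z₀ r`. [folklore] -/
theorem exists_preimage [CompleteSpace E] (p : E → E) (p' : E → (E →L[ℝ] E)) (z₀ : E)
    (r : ℝ) (hr : 0 < r) (hp : ∀ z ∈ closedBall z₀ r, HasFDerivAt p (p' z) z)
    (hd : ∀ z ∈ closedBall z₀ r, ‖p' z - ContinuousLinearMap.id ℝ E‖ ≤ 1 / 2)
    (h0 : ‖p z₀ - z₀‖ ≤ r / 4) {y : E} (hy : y ∈ closedBall z₀ (r / 4)) :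
    ∃ x ∈ closedBall z₀ r, p x = y := by
  set T : E → E := fun x => x - (p x - y) with hT
  have hy' : ‖y - z₀‖ ≤ r / 4 := by rwa [mem_closedBall, dist_eq_norm] at hy
  have hmaps : MapsTo T (closedBall z₀ r) (closedBall z₀ r) := by
    intro x hx
    have h1 := norm_sub_sub_le p p' z₀ r hp hd (mem_closedBall_self hr.le) hx
    rw [mem_closedBall, dist_eq_norm] at hx ⊢
    calc ‖T x - z₀‖ = ‖-(p x - p z₀ - (x - z₀)) - (p z₀ - z₀) + (y - z₀)‖ := by
          simp only [hT]; congr 1; abel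
      _ ≤ ‖-(p x - p z₀ - (x - z₀))‖ + ‖p z₀ - z₀‖ + ‖y - z₀‖ :=
          norm_add_le_of_le (norm_sub_le _ _) le_rfl
      _ = ‖p x - p z₀ - (x - z₀)‖ + ‖p z₀ - z₀‖ + ‖y - z₀‖ := by rw [norm_neg]
      _ ≤ 1 / 2 * ‖x - z₀‖ + r / 4 + r / 4 := by gcongr
      _ ≤ 1 / 2 * r + r / 4 + r / 4 := by gcongr
      _ = r := by ring
  have hlip : LipschitzOnWith (1 / 2 : ℝ≥0) T (closedBall z₀ r) := by
    refine LipschitzOnWith.of_dist_le_mul fun x hx x' hx' => ?_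
    rw [dist_eq_norm, dist_eq_norm]
    have h1 := norm_sub_sub_le p p' z₀ r hp hd hx' hx
    calc ‖T x - T x'‖ = ‖-(p x - p x' - (x - x'))‖ := by simp only [hT]; congr 1; abel
      _ = ‖p x - p x' - (x - x')‖ := norm_neg _
      _ ≤ 1 / 2 * ‖x - x'‖ := h1
      _ = ((1 / 2 : ℝ≥0) : ℝ) * ‖x - x'‖ := by norm_num
  have hcontr : ContractingWith (1 / 2 : ℝ≥0)
      (hmaps.restrict T (closedBall z₀ r) (closedBall z₀ r)) :=
    ⟨by norm_num, hlip.mapsToRestrict hmaps⟩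
  obtain ⟨x, hxs, hfix, -⟩ := ContractingWith.exists_fixedPoint' isClosed_closedBall.isComplete
    hmaps hcontr (mem_closedBall_self hr.le) (edist_ne_top _ _)
  refine ⟨x, hxs, ?_⟩
  have hx : x - (p x - y) = x := hfix
  exact sub_eq_zero.1 (sub_eq_self.1 hx)

/-- **Quantitative inverse function theorem for a `C¹`-small perturbation of the identity on a
closed ball of a Banach space**: if `‖p' z - id‖ ≤ 1/2` on `closedBall z₀ r` and
`‖p z₀ - z₀‖ ≤ r/4`, then `p` is injective on the ball and onto the quarter ball
`closedBall z₀ (r/4)`, with a `2`-Lipschitz right inverse taking values in the ball. [folklore] -/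
theorem perturbedIdentityInverse [CompleteSpace E] (p : E → E) (p' : E → (E →L[ℝ] E))
    (z₀ : E) (r : ℝ) (hr : 0 < r) (hp : ∀ z ∈ closedBall z₀ r, HasFDerivAt p (p' z) z)
    (hd : ∀ z ∈ closedBall z₀ r, ‖p' z - ContinuousLinearMap.id ℝ E‖ ≤ 1 / 2)
    (h0 : ‖p z₀ - z₀‖ ≤ r / 4) :
    InjOn p (closedBall z₀ r) ∧
    ∃ q : E → E, (∀ y ∈ closedBall z₀ (r / 4), q y ∈ closedBall z₀ r ∧ p (q y) = y) ∧
      ∀ y ∈ closedBall z₀ (r / 4), ∀ y' ∈ closedBall z₀ (r / 4), ‖q y - q y'‖ ≤ 2 * ‖y - y'‖ := by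
  refine ⟨?_, ?_⟩
  · intro x hx y hy hxy
    have h := norm_sub_le_two_mul p p' z₀ r hp hd hx hy
    rw [hxy, sub_self, norm_zero, mul_zero] at h
    exact (sub_eq_zero.mp (norm_le_zero_iff.mp h)).symm
  · have hex : ∀ y ∈ closedBall z₀ (r / 4), ∃ x ∈ closedBall z₀ r, p x = y :=
      fun y hy => exists_preimage p p' z₀ r hr hp hd h0 hy
    choose! q hq using hex
    refine ⟨q, fun y hy => hq y hy, fun y hy y' hy' => ?_⟩
    have h := norm_sub_le_two_mul p p' z₀ r hp hd (hq y' hy').1 (hq y hy).1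
    rwa [(hq y hy).2, (hq y' hy').2] at h

end PerturbedIdentity

/-! ### Composition on the left and uniform convergence -/

/-- Composition on the left with a map that is continuous at every point of a compact set
containing the image of the limit preserves uniform convergence on a set (Heine–Cantor in the
form `IsCompact.uniformContinuousAt_of_continuousAt`). [folklore] -/
theorem tendstoUniformlyOn_comp_left {α β γ ι : Type*} [UniformSpace β] [UniformSpace γ]
    {Φ : ι → α → β} {f : α → β} {p : Filter ι} {s : Set α} {t : Set β} (g : β → γ)
    (ht : IsCompact t) (hg : ∀ b ∈ t, ContinuousAt g b) (hft : ∀ x ∈ s, f x ∈ t)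
    (h : TendstoUniformlyOn Φ f p s) :
    TendstoUniformlyOn (fun i x => g (Φ i x)) (fun x => g (f x)) p s := by
  intro r hr
  filter_upwards [h _ (ht.uniformContinuousAt_of_continuousAt g hg hr)] with i hi x hx
  exact hi x hx (hft x hx)

/-- A sequence converging uniformly on `s` to a limit mapping `s` into a compact subset of an
open set `U` eventually maps `s` into `U`. [folklore] -/
theorem eventually_mem_of_tendstoUniformlyOn {α β ι : Type*} [PseudoMetricSpace β]
    {Φ : ι → α → β} {f : α → β} {p : Filter ι} {s : Set α} {t U : Set β}
    (ht : IsCompact t) (hU : IsOpen U) (htU : t ⊆ U) (hft : ∀ x ∈ s, f x ∈ t)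
    (h : TendstoUniformlyOn Φ f p s) : ∀ᶠ i in p, ∀ x ∈ s, Φ i x ∈ U := by
  obtain ⟨δ, hδ, hδU⟩ := ht.exists_thickening_subset_open hU htU
  filter_upwards [Metric.tendstoUniformlyOn_iff.1 h δ hδ] with i hi x hx
  exact hδU (mem_thickening_iff.2 ⟨f x, hft x hx, by rw [dist_comm]; exact hi x hx⟩)

/-- **`C¹`-convergence survives a smooth change of coordinates (local hypotheses).** If
`u n → v` locally uniformly on an open `W ⊆ ℂ` together with first derivatives, the `u n` are
`C^∞` on `W`, `v` is `C^∞`, `Λ` is `C^∞` on an open `U`, and `K ⊆ W` is compact with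
`v '' K ⊆ U`, then on `K` the maps `Λ ∘ u n → Λ ∘ v` converge uniformly together with their
derivatives, and eventually `u n '' K ⊆ U`. [folklore] -/
theorem composeC1Convergence (Λ : F → ℂ × ℂ) (U : Set F) (hU : IsOpen U)
    (hΛ : ContDiffOn ℝ ∞ Λ U) {W : Set ℂ} (hW : IsOpen W) (u : ℕ → ℂ → F) (v : ℂ → F)
    (hu : ∀ n, ContDiffOn ℝ ∞ (u n) W) (hv : ContDiff ℝ ∞ v)
    (hloc : TendstoLocallyUniformlyOn u v atTop W)
    (hdloc : TendstoLocallyUniformlyOn (fun n => fderiv ℝ (u n)) (fderiv ℝ v) atTop W)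
    (K : Set ℂ) (hK : IsCompact K) (hKW : K ⊆ W) (hKU : ∀ ζ ∈ K, v ζ ∈ U) :
    TendstoUniformlyOn (fun n ζ => Λ (u n ζ)) (fun ζ => Λ (v ζ)) atTop K ∧
    TendstoUniformlyOn (fun n ζ => fderiv ℝ (fun ζ => Λ (u n ζ)) ζ)
      (fun ζ => fderiv ℝ (fun ζ => Λ (v ζ)) ζ) atTop K ∧
    (∀ᶠ n in atTop, ∀ ζ ∈ K, u n ζ ∈ U) := by
  -- uniform convergence (of maps and derivatives) on the compact `K`
  have hK0 : TendstoUniformlyOn u v atTop K :=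
    (tendstoLocallyUniformlyOn_iff_forall_isCompact hW).1 hloc K hKW hK
  have hK1 : TendstoUniformlyOn (fun n => fderiv ℝ (u n)) (fderiv ℝ v) atTop K :=
    (tendstoLocallyUniformlyOn_iff_forall_isCompact hW).1 hdloc K hKW hK
  -- the compact image `v '' K ⊆ U`
  have hvK : IsCompact (v '' K) := hK.image hv.continuous
  have hvKU : v '' K ⊆ U := by
    rintro _ ⟨ζ, hζ, rfl⟩
    exact hKU ζ hζ
  have hmem : ∀ ζ ∈ K, v ζ ∈ v '' K := fun ζ hζ => mem_image_of_mem v hζ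
  -- eventually `u n '' K ⊆ U`
  have hev : ∀ᶠ n in atTop, ∀ ζ ∈ K, u n ζ ∈ U :=
    eventually_mem_of_tendstoUniformlyOn hvK hU hvKU hmem hK0
  -- continuity / differentiability of `Λ` and continuity of `fderiv ℝ Λ` at points of `U`
  have hΛc : ∀ p ∈ U, ContinuousAt Λ p := fun p hp =>
    hΛ.continuousOn.continuousAt (hU.mem_nhds hp)
  have hΛd : ∀ p ∈ U, DifferentiableAt ℝ Λ p := fun p hp =>
    (hΛ.differentiableOn (by simp)).differentiableAt (hU.mem_nhds hp)
  have hΛfc : ContinuousOn (fderiv ℝ Λ) U := hΛ.continuousOn_fderiv_of_isOpen hU (by simp)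
  have hud : ∀ n, ∀ ζ ∈ K, DifferentiableAt ℝ (u n) ζ := fun n ζ hζ =>
    ((hu n).differentiableOn (by simp)).differentiableAt (hW.mem_nhds (hKW hζ))
  refine ⟨tendstoUniformlyOn_comp_left Λ hvK (fun b hb => hΛc b (hvKU hb)) hmem hK0, ?_, hev⟩
  -- pairs (point, derivative) converge uniformly on `K`
  have hG : TendstoUniformlyOn (fun n ζ => (u n ζ, fderiv ℝ (u n) ζ))
      (fun ζ => (v ζ, fderiv ℝ v ζ)) atTop K :=
    fun r hr => tendsto_diag.eventually ((hK0.prodMk hK1) r hr)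
  have hgK : IsCompact ((fun ζ => (v ζ, fderiv ℝ v ζ)) '' K) :=
    hK.image (hv.continuous.prodMk (hv.continuous_fderiv (by simp)))
  -- the composition map `(p, B) ↦ (fderiv ℝ Λ p) ∘L B` is continuous on the open `U ×ˢ univ`
  have hΦ : ContinuousOn (fun q : F × (ℂ →L[ℝ] F) => (fderiv ℝ Λ q.1).comp q.2)
      (U ×ˢ (univ : Set (ℂ →L[ℝ] F))) :=
    (hΛfc.comp continuousOn_fst fun q hq => hq.1).clm_comp continuousOn_snd
  have hΦc : ∀ q ∈ (fun ζ => (v ζ, fderiv ℝ v ζ)) '' K,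
      ContinuousAt (fun q : F × (ℂ →L[ℝ] F) => (fderiv ℝ Λ q.1).comp q.2) q := by
    rintro _ ⟨ζ, hζ, rfl⟩
    exact hΦ.continuousAt ((hU.prod isOpen_univ).mem_nhds ⟨hKU ζ hζ, mem_univ _⟩)
  have hmain := tendstoUniformlyOn_comp_left _ hgK hΦc
    (fun ζ hζ => mem_image_of_mem (fun ζ => (v ζ, fderiv ℝ v ζ)) hζ) hG
  -- chain rule on `K` (eventually, once `u n '' K ⊆ U`) and for the limit
  refine (hmain.congr ?_).congr_right ?_
  · filter_upwards [hev] with n hn ζ hζ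
    exact (fderiv_fun_comp ζ (hΛd _ (hn ζ hζ)) (hud n ζ hζ)).symm
  · intro ζ hζ
    exact (fderiv_fun_comp ζ (hΛd _ (hKU ζ hζ)) (hv.differentiable (by simp) ζ)).symm

/-! ### The first sheet of the approximants is a graph over the axis -/

/-- On a closed disc `K₁ = closedBall ξ r₁ ⊆ W` on which `Λ ∘ v` is the inclusion `ζ ↦ (ζ, 0)`
of the axis, the first coordinate `P_n := (Λ ∘ u n).1` of `C¹`-approximants is eventually
`C¹`-close to the identity, hence (`perturbedIdentityInverse`) has a continuous right inverse
`g` on the quarter disc with values in `K₁`; and eventually `u n '' K₁ ⊆ U`. [folklore] -/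
theorem eventually_graph {Λ : F → ℂ × ℂ} {U : Set F} (hU : IsOpen U)
    (hΛ : ContDiffOn ℝ ∞ Λ U) {W : Set ℂ} (hW : IsOpen W) {u : ℕ → ℂ → F} {v : ℂ → F}
    (hu : ∀ n, ContDiffOn ℝ ∞ (u n) W) (hv : ContDiff ℝ ∞ v)
    (hloc : TendstoLocallyUniformlyOn u v atTop W)
    (hdloc : TendstoLocallyUniformlyOn (fun n => fderiv ℝ (u n)) (fderiv ℝ v) atTop W)
    {ξ : ℂ} {r₁ : ℝ} (hr₁ : 0 < r₁) (hKW : closedBall ξ r₁ ⊆ W)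
    (hKU : ∀ ζ ∈ closedBall ξ r₁, v ζ ∈ U)
    (hflat : ∀ ζ ∈ closedBall ξ r₁,
      (fun ζ => Λ (v ζ)) =ᶠ[𝓝 ζ] ⇑(ContinuousLinearMap.inl ℝ ℂ ℂ)) :
    ∀ᶠ n in atTop, (∀ ζ ∈ closedBall ξ r₁, u n ζ ∈ U) ∧
      ∃ g : ℂ → ℂ, (∀ y ∈ closedBall ξ (r₁ / 4),
          g y ∈ closedBall ξ r₁ ∧ (Λ (u n (g y))).1 = y) ∧
        ContinuousOn g (closedBall ξ (r₁ / 4)) := by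
  obtain ⟨h0, h1, hU'⟩ := composeC1Convergence Λ U hU hΛ hW u v hu hv hloc hdloc
    (closedBall ξ r₁) (isCompact_closedBall ξ r₁) hKW hKU
  filter_upwards [hU', Metric.tendstoUniformlyOn_iff.1 h0 (r₁ / 4) (by positivity),
    Metric.tendstoUniformlyOn_iff.1 h1 (1 / 2) one_half_pos] with n hn hn0 hn1
  refine ⟨hn, ?_⟩
  have hΛd : ∀ p ∈ U, DifferentiableAt ℝ Λ p := fun p hp =>
    (hΛ.differentiableOn (by simp)).differentiableAt (hU.mem_nhds hp)
  have hdiff : ∀ z ∈ closedBall ξ r₁, DifferentiableAt ℝ (fun ζ => Λ (u n ζ)) z :=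
    fun z hz => (hΛd _ (hn z hz)).comp z
      (((hu n).differentiableOn (by simp)).differentiableAt (hW.mem_nhds (hKW hz)))
  -- the first coordinate `P_n` and its derivative
  have hPd : ∀ z ∈ closedBall ξ r₁, HasFDerivAt (fun ζ => (Λ (u n ζ)).1)
      (fderiv ℝ (fun ζ => (Λ (u n ζ)).1) z) z :=
    fun z hz => (hdiff z hz).fst.hasFDerivAt
  have hder : ∀ z ∈ closedBall ξ r₁,
      ‖fderiv ℝ (fun ζ => (Λ (u n ζ)).1) z - ContinuousLinearMap.id ℝ ℂ‖ ≤ 1 / 2 := by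
    intro z hz
    have hA : ‖fderiv ℝ (fun ζ => Λ (u n ζ)) z - fderiv ℝ (fun ζ => Λ (v ζ)) z‖ < 1 / 2 := by
      rw [← dist_eq_norm, dist_comm]
      exact hn1 z hz
    have hlim : fderiv ℝ (fun ζ => Λ (v ζ)) z = ContinuousLinearMap.inl ℝ ℂ ℂ := by
      rw [(hflat z hz).fderiv_eq]
      exact (ContinuousLinearMap.inl ℝ ℂ ℂ).fderiv
    refine ContinuousLinearMap.opNorm_le_bound _ (by norm_num) fun x => ?_
    have hx : (fderiv ℝ (fun ζ => (Λ (u n ζ)).1) z - ContinuousLinearMap.id ℝ ℂ) x =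
        ((fderiv ℝ (fun ζ => Λ (u n ζ)) z - fderiv ℝ (fun ζ => Λ (v ζ)) z) x).1 := by
      rw [fderiv.fst (hdiff z hz), hlim]
      simp
    rw [hx]
    exact (norm_fst_le _).trans ((ContinuousLinearMap.le_opNorm _ _).trans
      (mul_le_mul_of_nonneg_right hA.le (norm_nonneg _)))
  have hP0 : ‖(Λ (u n ξ)).1 - ξ‖ ≤ r₁ / 4 := by
    have hva : Λ (v ξ) = (ξ, 0) := by
      simpa using (hflat ξ (mem_closedBall_self hr₁.le)).eq_of_nhds
    have h := hn0 ξ (mem_closedBall_self hr₁.le)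
    rw [hva, dist_comm, dist_eq_norm] at h
    calc ‖(Λ (u n ξ)).1 - ξ‖ = ‖(Λ (u n ξ) - (ξ, 0)).1‖ := by simp
      _ ≤ ‖Λ (u n ξ) - (ξ, 0)‖ := norm_fst_le _
      _ ≤ r₁ / 4 := h.le
  obtain ⟨-, g, hg, hgl⟩ := perturbedIdentityInverse (fun ζ => (Λ (u n ζ)).1)
    (fderiv ℝ (fun ζ => (Λ (u n ζ)).1)) ξ r₁ hr₁ hPd hder hP0
  refine ⟨g, hg, ?_⟩
  have hL : LipschitzOnWith 2 g (closedBall ξ (r₁ / 4)) :=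
    LipschitzOnWith.of_dist_le_mul fun y hy y' hy' => by
      simpa only [dist_eq_norm, NNReal.coe_ofNat] using hgl y hy y' hy'
  exact hL.continuousOn

/-! ### The functions `d_n` and their convergence to the normal coordinate -/

omit [NormedSpace ℝ F] in
/-- Continuity on `K₂` of `d ζ := (Λ (u' ζ)).2 - (Λ (w' (g (Λ (u' ζ)).1))).2` from the mapping
properties `(Λ ∘ u').1 '' K₂ ⊆ S`, `g '' S ⊆ K₁`, `w' '' K₁ ∪ u' '' K₂ ⊆ U`. [folklore] -/
theorem continuousOn_d {Λ : F → ℂ × ℂ} {U : Set F} (hΛc : ContinuousOn Λ U) {u' w' : ℂ → F}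
    {K₁ K₂ S : Set ℂ} {g : ℂ → ℂ} (hu' : ContinuousOn u' K₂) (hw' : ContinuousOn w' K₁)
    (h1 : ∀ z ∈ K₁, w' z ∈ U) (h4 : ∀ z ∈ K₂, u' z ∈ U) (hgS : ∀ y ∈ S, g y ∈ K₁)
    (hgc : ContinuousOn g S) (h5 : ∀ z ∈ K₂, (Λ (u' z)).1 ∈ S) :
    ContinuousOn (fun ζ => (Λ (u' ζ)).2 - (Λ (w' (g ((Λ (u' ζ)).1)))).2) K₂ := by
  have hK₂ : ContinuousOn (fun ζ => Λ (u' ζ)) K₂ := hΛc.comp hu' h4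
  have hK₁ : ContinuousOn (fun ζ => (Λ (w' ζ)).2) K₁ := (hΛc.comp hw' h1).snd
  have hg' : ContinuousOn (fun ζ => g ((Λ (u' ζ)).1)) K₂ := hgc.comp hK₂.fst h5
  exact hK₂.snd.sub (hK₁.comp hg' fun z hz => hgS _ (h5 z hz))

omit [NormedAddCommGroup F] [NormedSpace ℝ F] in
/-- Uniform convergence `d_k → c = (Λ ∘ v).2` on `T ⊆ K₂`, where
`d_k ζ := Q_n ζ - Q'_n (g_k (P_n ζ))`, `n = k + N`, `(P_n, Q_n) := Λ ∘ u n`,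
`Q'_n := (Λ ∘ w n).2`: the first term converges to `c` uniformly on `K₂`, and the correction is
evaluated at a point of `K₁`, where `Q'_n → (Λ ∘ b).2 = 0` uniformly. [folklore] -/
theorem tendstoUniformlyOn_d {Λ : F → ℂ × ℂ} {u w : ℕ → ℂ → F} {v b : ℂ → F}
    {K₁ K₂ S T : Set ℂ} {N : ℕ} {g : ℕ → ℂ → ℂ}
    (hK₁ : TendstoUniformlyOn (fun n ζ => Λ (w n ζ)) (fun ζ => Λ (b ζ)) atTop K₁)
    (hK₂ : TendstoUniformlyOn (fun n ζ => Λ (u n ζ)) (fun ζ => Λ (v ζ)) atTop K₂)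
    (hflat : ∀ ζ ∈ K₁, (Λ (b ζ)).2 = 0) (hgS : ∀ k, ∀ y ∈ S, g k y ∈ K₁)
    (h5 : ∀ k, ∀ z ∈ K₂, (Λ (u (k + N) z)).1 ∈ S) (hT : T ⊆ K₂) :
    TendstoUniformlyOn
      (fun k ζ => (Λ (u (k + N) ζ)).2 - (Λ (w (k + N) (g k ((Λ (u (k + N) ζ)).1)))).2)
      (fun ζ => (Λ (v ζ)).2) atTop T := by
  rw [Metric.tendstoUniformlyOn_iff]
  intro ε' hε'
  have e1 := (tendsto_add_atTop_nat N).eventually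
    (Metric.tendstoUniformlyOn_iff.1 hK₁ (ε' / 2) (half_pos hε'))
  have e2 := (tendsto_add_atTop_nat N).eventually
    (Metric.tendstoUniformlyOn_iff.1 hK₂ (ε' / 2) (half_pos hε'))
  filter_upwards [e1, e2] with k hk1 hk2 ζ hζ
  have hζ' : g k ((Λ (u (k + N) ζ)).1) ∈ K₁ := hgS k _ (h5 k ζ (hT hζ))
  have hA : ‖(Λ (v ζ)).2 - (Λ (u (k + N) ζ)).2‖ < ε' / 2 := by
    have h := hk2 ζ (hT hζ)
    rw [dist_eq_norm] at h
    calc ‖(Λ (v ζ)).2 - (Λ (u (k + N) ζ)).2‖ = ‖(Λ (v ζ) - Λ (u (k + N) ζ)).2‖ := by simp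
      _ ≤ ‖Λ (v ζ) - Λ (u (k + N) ζ)‖ := norm_snd_le _
      _ < ε' / 2 := h
  have hB : ‖(Λ (w (k + N) (g k ((Λ (u (k + N) ζ)).1)))).2‖ < ε' / 2 := by
    have h := hk1 _ hζ'
    rw [dist_comm, dist_eq_norm] at h
    calc ‖(Λ (w (k + N) (g k ((Λ (u (k + N) ζ)).1)))).2‖
        = ‖(Λ (w (k + N) (g k ((Λ (u (k + N) ζ)).1))) -
            Λ (b (g k ((Λ (u (k + N) ζ)).1)))).2‖ := by simp [hflat _ hζ']
      _ ≤ ‖Λ (w (k + N) (g k ((Λ (u (k + N) ζ)).1))) - Λ (b (g k ((Λ (u (k + N) ζ)).1)))‖ :=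
          norm_snd_le _
      _ < ε' / 2 := h
  rw [dist_eq_norm]
  calc ‖(Λ (v ζ)).2 - ((Λ (u (k + N) ζ)).2 - (Λ (w (k + N) (g k ((Λ (u (k + N) ζ)).1)))).2)‖
      = ‖((Λ (v ζ)).2 - (Λ (u (k + N) ζ)).2) +
          (Λ (w (k + N) (g k ((Λ (u (k + N) ζ)).1)))).2‖ := by
        rw [sub_sub_eq_add_sub, add_sub_right_comm]
    _ ≤ ‖(Λ (v ζ)).2 - (Λ (u (k + N) ζ)).2‖ +
          ‖(Λ (w (k + N) (g k ((Λ (u (k + N) ζ)).1)))).2‖ := norm_add_le _ _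
    _ < ε' / 2 + ε' / 2 := add_lt_add hA hB
    _ = ε' := add_halves ε'

end IntersectionPersist

open IntersectionPersist

/-! ### Persistence of an isolated intersection (flat form) -/

/-- **Positivity of intersections, persistence form, in a single chart (McDuff 1991, Thm 1.1 and
§5 (5.1) cases (i)–(ii); Lemma 4.2(ii), Lemma 4.3).** Let `dim F = 4`, `J` a smooth operator
field; `b : ℂ → F` smooth, `J`-holomorphic on `B(0, R₁)` with `J² = -1` along it and immersed at
`0`; `v : ℂ → F` smooth, `J`-holomorphic on `B(0, R₂)`, `v 0 = b 0`; and suppose the intersection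
is ISOLATED: `v s = b t` with `s, t ∈ B(0, ρ₁)` only for `s = t = 0`. Let `u n → v` locally
uniformly on an open `W ∋ 0` (`u n` continuous on `W`) and `w n → b` locally uniformly on `W`
together with first derivatives (`w n` smooth on `W`). Then for every `ρ > 0`, for all large `n`
there are `s, t ∈ B(0, ρ)` with `u n s = w n t` (the local intersection index of `v` with the
sheet `b` at the point is `≥ 1`, and it is invariant under small deformation).
[cite: McDuff1991LocalBehaviour, Thm 1.1, §5 (5.1)(i)-(ii), Lemma 4.2(ii)] -/
theorem isolatedIntersection_persists_flat [FiniteDimensional ℝ F]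
    (h4 : Module.finrank ℝ F = 4) {J : F → F →L[ℝ] F} (hJ : ContDiff ℝ ∞ J)
    {b v : ℂ → F} {R₁ R₂ : ℝ} (hR₁ : 0 < R₁) (hR₂ : 0 < R₂) (hb : ContDiff ℝ ∞ b)
    (hbJ : ∀ z ∈ ball (0 : ℂ) R₁, ∀ α : ℂ,
      fderiv ℝ b z (Complex.I * α) = J (b z) (fderiv ℝ b z α))
    (hJ2 : ∀ z ∈ ball (0 : ℂ) R₁, ∀ x : F, J (b z) (J (b z) x) = -x)
    (hinj : Injective (fderiv ℝ b 0)) (hv : ContDiff ℝ ∞ v)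
    (hvJ : ∀ z ∈ ball (0 : ℂ) R₂, ∀ α : ℂ,
      fderiv ℝ v z (Complex.I * α) = J (v z) (fderiv ℝ v z α))
    (hx : v 0 = b 0) {ρ₁ : ℝ} (hρ₁ : 0 < ρ₁)
    (hiso : ∀ s ∈ ball (0 : ℂ) ρ₁, ∀ t ∈ ball (0 : ℂ) ρ₁, v s = b t → s = 0 ∧ t = 0)
    {W : Set ℂ} (hW : IsOpen W) (h0W : (0 : ℂ) ∈ W) {u w : ℕ → ℂ → F}
    (hu : ∀ n, ContinuousOn (u n) W) (hw : ∀ n, ContDiffOn ℝ ∞ (w n) W)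
    (hul : TendstoLocallyUniformlyOn u v atTop W)
    (hwl : TendstoLocallyUniformlyOn w b atTop W)
    (hdwl : TendstoLocallyUniformlyOn (fun n => fderiv ℝ (w n)) (fderiv ℝ b) atTop W)
    {ρ : ℝ} (hρ : 0 < ρ) :
    ∀ᶠ n in atTop, ∃ s ∈ ball (0 : ℂ) ρ, ∃ t ∈ ball (0 : ℂ) ρ, u n s = w n t := by
  -- Step 1: the sheet chart `e` of `b` and the dichotomy for the normal coordinate of `v`
  obtain ⟨ν₀, e, ρ₀, hcoe, hsrc, hsymm, hρ₀, htgt, hdich⟩ :=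
    sheet_dichotomy h4 hJ hR₁ hR₂ hb hbJ hJ2 hinj hv hvJ hx
  have he0 : ∀ ζ : ℂ, e (ζ, 0) = b ζ := fun ζ => by rw [hcoe, sheetChart_mk_zero]
  have hxt : b 0 ∈ e.target := by rw [← he0]; exact e.map_source hsrc
  have hs0 : e.symm (b 0) = (0, 0) := by rw [← he0]; exact e.left_inv hsrc
  have hvt : v 0 ∈ e.target := by rw [hx]; exact hxt
  have hcont0 : ContinuousAt (fun ζ => e.symm (v ζ)) 0 :=
    (e.continuousAt_symm hvt).comp hv.continuous.continuousAt
  have hsv0 : e.symm (v 0) = (0, 0) := by rw [hx, hs0]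
  -- Step 2: the intersection is isolated, so the normal coordinate is not identically zero
  have hne : ¬ (∀ᶠ ζ in 𝓝 (0 : ℂ), (e.symm (v ζ)).2 = 0) := by
    intro hev
    have h1 : ∀ᶠ ζ in 𝓝 (0 : ℂ), v ζ ∈ e.target :=
      hv.continuous.continuousAt.eventually_mem (e.open_target.mem_nhds hvt)
    have h2 : ∀ᶠ ζ in 𝓝 (0 : ℂ), e.symm (v ζ) ∈ ball ((0 : ℂ), (0 : ℂ)) ρ₁ :=
      hcont0.eventually_mem (isOpen_ball.mem_nhds (by rw [hsv0]; exact mem_ball_self hρ₁))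
    have h3 : ∀ᶠ ζ in 𝓝 (0 : ℂ), ζ ∈ ball (0 : ℂ) ρ₁ := isOpen_ball.mem_nhds (mem_ball_self hρ₁)
    obtain ⟨τ, hτ, hτb⟩ := Metric.eventually_nhds_iff_ball.1 (hev.and (h1.and (h2.and h3)))
    have hmem : ((τ / 2 : ℝ) : ℂ) ∈ ball (0 : ℂ) τ := by
      rw [mem_ball_zero_iff, Complex.norm_real, Real.norm_eq_abs, abs_of_pos (half_pos hτ)]
      exact half_lt_self hτ
    obtain ⟨hc0, ht, hb1, hz1⟩ := hτb _ hmem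
    have heq : v ((τ / 2 : ℝ) : ℂ) = b (e.symm (v ((τ / 2 : ℝ) : ℂ))).1 :=
      eq_sheet_of_snd_symm_eq_zero hcoe ht hc0
    have hfst : (e.symm (v ((τ / 2 : ℝ) : ℂ))).1 ∈ ball (0 : ℂ) ρ₁ := by
      rw [mem_ball, Prod.dist_eq] at hb1
      exact mem_ball.2 ((le_max_left _ _).trans_lt hb1)
    have h0 := (hiso _ hz1 _ hfst heq).1
    have h0' : (τ / 2 : ℝ) = 0 := by exact_mod_cast h0
    linarith
  -- Step 3: `0` is an isolated zero of the normal coordinate, of positive winding number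
  obtain ⟨ε, hε, hερ₀, hzf, hwind⟩ := hdich.resolve_left hne
  -- Step 4 (a): the disc `K₁ = closedBall 0 r₁` of the first sheet
  have hevA : ∀ᶠ ζ in 𝓝 (0 : ℂ), ζ ∈ W ∧ b ζ ∈ e.target ∧ ((ζ, (0 : ℂ)) : ℂ × ℂ) ∈ e.source := by
    refine (hW.eventually_mem h0W).and ((hb.continuous.continuousAt.eventually_mem
      (e.open_target.mem_nhds hxt)).and ?_)
    have hc : Continuous fun ζ : ℂ => ((ζ, (0 : ℂ)) : ℂ × ℂ) := by fun_prop
    exact hc.continuousAt.eventually_mem (e.open_source.mem_nhds hsrc)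
  obtain ⟨r₀, hr₀, hr₀b⟩ := Metric.eventually_nhds_iff_ball.1 hevA
  set r₁ : ℝ := min (r₀ / 2) (ρ / 2) with hr₁_def
  have hr₁ : 0 < r₁ := lt_min (half_pos hr₀) (half_pos hρ)
  have hr₁ρ : r₁ < ρ := (min_le_right _ _).trans_lt (half_lt_self hρ)
  have hK₁ : closedBall (0 : ℂ) r₁ ⊆ ball 0 r₀ :=
    closedBall_subset_ball ((min_le_left _ _).trans_lt (half_lt_self hr₀))
  have hK₁W : closedBall (0 : ℂ) r₁ ⊆ W := fun ζ hζ => (hr₀b ζ (hK₁ hζ)).1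
  have hK₁t : ∀ ζ ∈ closedBall (0 : ℂ) r₁, b ζ ∈ e.target := fun ζ hζ => (hr₀b ζ (hK₁ hζ)).2.1
  have hcurve : ∀ ζ ∈ ball (0 : ℂ) r₀, e.symm (b ζ) = (ζ, 0) := fun ζ hζ => by
    rw [← he0]
    exact e.left_inv (hr₀b ζ hζ).2.2
  have hflat : ∀ ζ ∈ closedBall (0 : ℂ) r₁,
      (fun ζ => e.symm (b ζ)) =ᶠ[𝓝 ζ] ⇑(ContinuousLinearMap.inl ℝ ℂ ℂ) := fun ζ hζ => by
    filter_upwards [isOpen_ball.mem_nhds (hK₁ hζ)] with ζ' hζ'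
    rw [ContinuousLinearMap.inl_apply]
    exact hcurve ζ' hζ'
  -- Step 4 (b): the disc `K₂ = closedBall 0 ε'` of the second sheet
  have hevB : ∀ᶠ ζ in 𝓝 (0 : ℂ), ζ ∈ W ∧ e.symm (v ζ) ∈ ball ((0 : ℂ), (0 : ℂ)) (r₁ / 8) :=
    (hW.eventually_mem h0W).and (hcont0.eventually_mem (isOpen_ball.mem_nhds (by
      rw [hsv0]; exact mem_ball_self (by positivity))))
  obtain ⟨τ, hτ, hτb⟩ := Metric.eventually_nhds_iff_ball.1 hevB
  set ε' : ℝ := min ε (min (τ / 2) (ρ / 2)) with hε'_def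
  have hε' : 0 < ε' := lt_min hε (lt_min (half_pos hτ) (half_pos hρ))
  have hε'ε : ε' ≤ ε := min_le_left _ _
  have hε'ρ : ε' < ρ := (min_le_right _ _).trans_lt ((min_le_right _ _).trans_lt (half_lt_self hρ))
  have hK₂τ : closedBall (0 : ℂ) ε' ⊆ ball 0 τ :=
    closedBall_subset_ball ((min_le_right _ _).trans_lt ((min_le_left _ _).trans_lt
      (half_lt_self hτ)))
  have hK₂W : closedBall (0 : ℂ) ε' ⊆ W := fun ζ hζ => (hτb ζ (hK₂τ hζ)).1
  have hK₂ρ₀ : closedBall (0 : ℂ) ε' ⊆ ball 0 ρ₀ := closedBall_subset_ball (hε'ε.trans_lt hερ₀)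
  have hK₂t : ∀ ζ ∈ closedBall (0 : ℂ) ε', v ζ ∈ e.target := fun ζ hζ => htgt ζ (hK₂ρ₀ hζ)
  have ha8 : ∀ ζ ∈ closedBall (0 : ℂ) ε', ‖(e.symm (v ζ)).1‖ < r₁ / 8 := fun ζ hζ => by
    have h := (hτb ζ (hK₂τ hζ)).2
    rw [mem_ball, Prod.dist_eq] at h
    have h1 := (le_max_left _ _).trans_lt h
    rwa [dist_zero_right] at h1
  have hwind' : wind (fun t => (e.symm (v (circleLoop 0 ε' t))).2) ≠ 0 := (hwind ε' hε' hε'ε).ne'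
  have hzf' : ∀ z ∈ sphere (0 : ℂ) ε', (e.symm (v z)).2 ≠ 0 := fun z hz => by
    rw [mem_sphere_iff_norm] at hz
    exact hzf z (by rw [hz]; exact hε') (by rw [hz]; exact hε'ε)
  -- Step 5: the first sheet of the approximants `w n` is a graph over the quarter disc
  have hG := eventually_graph e.open_target hsymm hW hw hb hwl hdwl hr₁ hK₁W hK₁t hflat
  obtain ⟨hT1, -, -⟩ := composeC1Convergence e.symm e.target e.open_target hsymm hW w b hw hb
    hwl hdwl (closedBall 0 r₁) (isCompact_closedBall 0 r₁) hK₁W hK₁t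
  -- Step 6: the second sheet of the approximants `u n`, read in the chart (`C⁰` only)
  have hvK₂ : IsCompact (v '' closedBall (0 : ℂ) ε') :=
    (isCompact_closedBall 0 ε').image hv.continuous
  have hvK₂t : v '' closedBall (0 : ℂ) ε' ⊆ e.target := by
    rintro _ ⟨ζ, hζ, rfl⟩
    exact hK₂t ζ hζ
  have hK₂0 : TendstoUniformlyOn u v atTop (closedBall (0 : ℂ) ε') :=
    (tendstoLocallyUniformlyOn_iff_forall_isCompact hW).1 hul _ hK₂W (isCompact_closedBall _ _)
  have hT2 : TendstoUniformlyOn (fun n ζ => e.symm (u n ζ)) (fun ζ => e.symm (v ζ)) atTop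
      (closedBall (0 : ℂ) ε') :=
    tendstoUniformlyOn_comp_left e.symm hvK₂ (fun y hy => e.continuousAt_symm (hvK₂t hy))
      (fun ζ hζ => mem_image_of_mem v hζ) hK₂0
  have hS : ∀ᶠ n in atTop, (∀ ζ ∈ closedBall (0 : ℂ) ε', u n ζ ∈ e.target) ∧
      ∀ ζ ∈ closedBall (0 : ℂ) ε', (e.symm (u n ζ)).1 ∈ closedBall (0 : ℂ) (r₁ / 4) := by
    have hev := eventually_mem_of_tendstoUniformlyOn hvK₂ e.open_target hvK₂t
      (fun ζ hζ => mem_image_of_mem v hζ) hK₂0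
    filter_upwards [hev, Metric.tendstoUniformlyOn_iff.1 hT2 (r₁ / 8) (by positivity)]
      with n hn hn0
    refine ⟨hn, fun ζ hζ => ?_⟩
    have h1 : ‖(e.symm (u n ζ)).1 - (e.symm (v ζ)).1‖ < r₁ / 8 := by
      have h := hn0 ζ hζ
      rw [dist_comm, dist_eq_norm] at h
      calc ‖(e.symm (u n ζ)).1 - (e.symm (v ζ)).1‖ = ‖(e.symm (u n ζ) - e.symm (v ζ)).1‖ := by
            simp
        _ ≤ ‖e.symm (u n ζ) - e.symm (v ζ)‖ := norm_fst_le _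
        _ < r₁ / 8 := h
    rw [mem_closedBall, dist_zero_right]
    have h2 := norm_le_norm_sub_add (e.symm (u n ζ)).1 (e.symm (v ζ)).1
    linarith [ha8 ζ hζ]
  -- Step 7: beyond `N` everything holds; right inverses `g k` and the functions `d k`
  obtain ⟨N, hN⟩ := eventually_atTop.1 (hG.and hS)
  have hN' : ∀ k : ℕ, ∃ g : ℂ → ℂ,
      (∀ ζ ∈ closedBall (0 : ℂ) r₁, w (k + N) ζ ∈ e.target) ∧
      (∀ y ∈ closedBall (0 : ℂ) (r₁ / 4), g y ∈ closedBall (0 : ℂ) r₁ ∧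
        (e.symm (w (k + N) (g y))).1 = y) ∧
      ContinuousOn g (closedBall (0 : ℂ) (r₁ / 4)) ∧
      (∀ ζ ∈ closedBall (0 : ℂ) ε', u (k + N) ζ ∈ e.target) ∧
      ∀ ζ ∈ closedBall (0 : ℂ) ε', (e.symm (u (k + N) ζ)).1 ∈ closedBall (0 : ℂ) (r₁ / 4) :=
    fun k => by
    obtain ⟨⟨h1, g, hg, hgc⟩, h4', h5⟩ := hN (k + N) (Nat.le_add_left N k)
    exact ⟨g, h1, hg, hgc, h4', h5⟩
  choose g h1 hg hgc h4' h5 using hN'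
  obtain ⟨d, hd⟩ : ∃ d : ℕ → ℂ → ℂ, ∀ k ζ, d k ζ =
      (e.symm (u (k + N) ζ)).2 - (e.symm (w (k + N) (g k ((e.symm (u (k + N) ζ)).1)))).2 :=
    ⟨_, fun _ _ => rfl⟩
  have hdcont : ∀ k, ContinuousOn (d k) (closedBall (0 : ℂ) ε') := fun k =>
    (continuousOn_d e.continuousOn_symm ((hu (k + N)).mono hK₂W)
      ((hw (k + N)).continuousOn.mono hK₁W) (h1 k) (h4' k)
      (fun y hy => (hg k y hy).1) (hgc k) (h5 k)).congr fun ζ _ => hd k ζ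
  have hdconv : TendstoUniformlyOn d (fun ζ => (e.symm (v ζ)).2) atTop (sphere (0 : ℂ) ε') := by
    refine (tendstoUniformlyOn_d hT1 hT2 (fun ζ hζ => ?_) (fun k y hy => (hg k y hy).1) h5
      sphere_subset_closedBall).congr (Eventually.of_forall fun k ζ _ => (hd k ζ).symm)
    rw [hcurve ζ (hK₁ hζ)]
  -- Step 8: zeros persist: eventually every `d k` vanishes somewhere in `K₂`
  have hcs : ContinuousOn (fun ζ => (e.symm (v ζ)).2) (sphere (0 : ℂ) ε') :=
    ((e.continuousOn_symm.comp hv.continuous.continuousOn hK₂t).snd).mono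
      sphere_subset_closedBall
  have hzero := eventually_exists_zero_of_tendstoUniformlyOn hε' hcs hzf' hwind' hdcont hdconv
  -- Step 9: a zero of `d k` is an intersection of `u (k + N)` and `w (k + N)`
  have hmain : ∀ᶠ k in atTop, ∃ s ∈ ball (0 : ℂ) ρ, ∃ t ∈ ball (0 : ℂ) ρ,
      u (k + N) s = w (k + N) t := by
    filter_upwards [hzero] with k ⟨z, hzK, hz0⟩
    rw [hd] at hz0
    obtain ⟨hζ'K, hPζ'⟩ := hg k _ (h5 k z hzK)
    have hΛeq : e.symm (u (k + N) z) = e.symm (w (k + N) (g k ((e.symm (u (k + N) z)).1))) :=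
      Prod.ext hPζ'.symm (sub_eq_zero.1 hz0)
    have heq : u (k + N) z = w (k + N) (g k ((e.symm (u (k + N) z)).1)) := by
      have hinj' := e.symm.injOn
      rw [e.symm_source] at hinj'
      exact hinj' (h4' k z hzK) (h1 k _ hζ'K) hΛeq
    exact ⟨z, closedBall_subset_ball hε'ρ hzK, _, closedBall_subset_ball hr₁ρ hζ'K, heq⟩
  -- Step 10: re-index `k + N ↦ n`
  obtain ⟨K₀, hK₀⟩ := eventually_atTop.1 hmain
  refine eventually_atTop.2 ⟨K₀ + N, fun n hn => ?_⟩
  have h := hK₀ (n - N) (by omega)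
  rwa [Nat.sub_add_cancel (by omega)] at h

end Literature.Geometry.Symplectic

end
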